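import Literature.NumberTheory.QuadraticFields.BinaryQuadraticFormsRepresentation
import Literature.NumberTheory.QuadraticFields.ReducedForms
import HarnessLib

/-!
# A class number one criterion: if the principal form represents every split prime, `h(D) = 1`

Topic `NumberTheory/QuadraticFields`; a proofs-only file (theorems only, no definitions, no named
facts) over `BinaryQuadraticFormsClassNumber.lean` / `BinaryQuadraticFormsRepresentation.lean`
(the `BinQF` encoding: `act`, `ProperEquiv`, Cox's Lemmas 2.3, 2.25 and Thm. 2.8) and
`ReducedForms.lean` (the triple encoding: `reducedForms D`, `classNumber D`, `principalForm D`).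

**Main result** (`Literature.NumberTheory.QuadraticFields.BinaryQuadraticForm.classNumber_eq_one_of_forall_prime_repr`).
Let `D < 0`, `D ≡ 0, 1 (mod 4)` and `M ≠ 0`. Suppose that every prime number `p` with `p ∤ M`,
`p ∤ D` and `D ≡ B² (mod p)` for some `B` — i.e. every prime `p ∤ M` at which `D` is a non-zero
square, equivalently (Cox, Lemma 2.5) every prime `p ∤ 2DM` represented by *some* primitive form of
discriminant `D` — is represented by the principal form of discriminant `D`. Then `h(D) = 1`.

In the language of ideals of the order `𝒪` of discriminant `D` this is the remark that the class
group `C(𝒪) ≅ C(D)` (Cox, *Primes of the form x² + ny²*, Thm. 7.7) is trivial as soon as the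
primes of `𝒪` of degree one and prime to `M` are principal: every class contains a proper ideal
prime to any given modulus (Cox, Cor. 7.17), which is a product of such primes and of (principal)
inert primes. It is the elementary half of the classical determination of `h(D)` for a CM curve
`E/ℚ` by reduction modulo split primes (Deuring), used in the tree to replace the First Main
Theorem of complex multiplication in the proof that a rational singular modulus has class number
one (`Literature/NumberTheory/EllipticCurves`, `hasCM_iff_j_mem`).

**Proof given here** (forms only, no ideals). By Lemma 2.25 with Lemma 2.3
(`BinQF.exists_properEquiv_isPosPrim_isCoprime_a`) every class contains a form `(n, B, C)` with
`gcd(n, MD) = 1`. *Division step* (`BinQF.properEquiv_div_of_prime_repr`): if a prime `p ∣ n`,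
`p ∤ D`, is represented by the principal form `(1, σ, k)`, `p = u² + σuv + kv²`, then
`(n, B, C) ~ (n/p, B, pC)` properly — the form `(n, B, C)` is the Dirichlet composition of
`(p, B, (n/p)C)` and `(n/p, B, pC)` (Cox, §3.A, (3.7)), and `(p, B, ·) ~ (1, σ, k)^{±1}`; we simply
write down the matrix `(W, −vC; v·n/p, pW + vB) ∈ SL₂(ℤ)`, `pW = u + v(σ − B)/2` (after possibly
replacing `(u, v)` by `(u + σv, −v)`), and check the identity (`BinQF.properEquiv_div_of_repr`).
Induction on `n` brings every class to `(1, B, C) ~ (1, σ, k)`; by the uniqueness of reduced forms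
(Thm. 2.8) the only reduced form is the principal one.

## References

* D. A. Cox, *Primes of the form x² + ny²*, 2nd ed., Wiley 2013: §2.A Lemma 2.3, Thm. 2.8,
  Thm. 2.13; §2.C Lemma 2.25 and the principal form; §3.A eq. (3.7) (Dirichlet composition);
  §7.B Thm. 7.7, §7.C Cor. 7.17. Held: `book:cox2013-primes-form-i-x-sup-2-sup`. [Cox2013]

## Design

Nothing is defined. The algebra is done on `BinQF` (namespace
`Literature.NumberTheory.QuadraticFields.Quadratic.BinQF`, dot-notation extensions as in the
sibling files); the main theorem is stated for the triple encoding of `ReducedForms.lean`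
(namespace `Literature.NumberTheory.QuadraticFields.BinaryQuadraticForm`), whose `classNumber`
is the one consumed under `Literature/NumberTheory/EllipticCurves`; the two encodings have
definitionally equal primitivity and reducedness predicates.
-/

namespace Literature.NumberTheory.QuadraticFields.Quadratic.BinQF

/-! ### Parity bookkeeping -/

/-- Two integers whose squares are congruent modulo `4` (indeed modulo `2`) have the same parity:
if `2 ∣ σ² − B²` then `2 ∣ σ − B`. [folklore] -/
theorem two_dvd_sub_of_two_dvd_sq_sub_sq {σ B : ℤ} (h : 2 ∣ σ ^ 2 - B ^ 2) : 2 ∣ σ - B := by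
  rw [← even_iff_two_dvd] at h ⊢
  rw [Int.even_sub, Int.even_pow' two_ne_zero, Int.even_pow' two_ne_zero] at h
  exact Int.even_sub.2 h

/-- If `σ² − 4k = B² − 4m` (two forms `(1, σ, k)`, `(·, B, ·)` of the same discriminant) then
`σ ≡ B (mod 2)`: there is `h` with `2h = σ − B`. [folklore] -/
theorem exists_two_mul_eq_sub_of_disc_eq {σ k B m : ℤ} (h : σ ^ 2 - 4 * k = B ^ 2 - 4 * m) :
    ∃ h : ℤ, 2 * h = σ - B := by
  obtain ⟨h, hh⟩ := two_dvd_sub_of_two_dvd_sq_sub_sq (σ := σ) (B := B) ⟨2 * (k - m), by linarith⟩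
  exact ⟨h, by linarith⟩

/-! ### The division step: `(pn', B, C) ~ (n', B, pC)` when the principal form represents `p` -/

/-- **Division step, explicit matrix.** Let `(p n', B, C)` and `(1, 2h + B, k)` have the same
discriminant, and let `p = u² + (2h + B)uv + kv²` with `p ∣ u + vh`, say `u + vh = pW` (`p ≠ 0`).
Then `γ = (W, −vC; vn', pW + vB)` lies in `SL₂(ℤ)` and `(p n', B, C)·γ = (n', B, pC)`; in
particular `(p n', B, C)` and `(n', B, pC)` are properly equivalent. (The lattice computation
behind it: for `π = u + v·ω`, `ω = h + (B + √D)/2… `, one has `π·[n', (−B+√D)/2] = [pn', (−B+√D)/2]`;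
Cox, §3.A (3.7) and §7.B Thm. 7.7.) [folklore] -/
theorem properEquiv_div_of_repr {p n' B C u v h k W : ℤ} (hp : p ≠ 0)
    (hdisc : (2 * h + B) ^ 2 - 4 * k = B ^ 2 - 4 * (p * n') * C)
    (hrep : p = u ^ 2 + (2 * h + B) * u * v + k * v ^ 2) (hW : u + v * h = p * W) :
    (⟨p * n', B, C⟩ : BinQF).ProperEquiv ⟨n', B, p * C⟩ := by
  -- eliminate `u` and `k`
  have hu : u = p * W - v * h := by linarith
  subst hu
  have hk : k = h ^ 2 + h * B + p * n' * C := by linarith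
  subst hk
  -- the key identity `p W² + B W v + n' C v² = 1`
  have hkey : p * (p * W ^ 2 + B * W * v + n' * C * v ^ 2 - 1) = 0 := by
    linear_combination -hrep
  have hdet : p * W ^ 2 + B * W * v + n' * C * v ^ 2 = 1 := by
    rcases mul_eq_zero.1 hkey with h0 | h0
    · exact absurd h0 hp
    · linarith
  refine ⟨W, -(v * C), v * n', p * W + v * B, ?_, ?_⟩
  · linear_combination hdet
  · ext
    · simp only [act]
      linear_combination (-n') * hdet
    · simp only [act]
      linear_combination (-B) * hdet
    · simp only [act]
      linear_combination (-(p * C)) * hdet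

/-- **Division step for a prime.** Let `f = (n, B, C)` with `n = p n'`, `p` prime, `p ∤ D`, where
`D = B² − 4nC = σ² − 4k`, and suppose the form `(1, σ, k)` represents `p`: `p = u² + σuv + kv²`.
Then `(n, B, C)` is properly equivalent to `(n', B, pC)`. Indeed with `2h₁ = σ − B`, `2h₂ = σ + B`
one has `(u + vh₁)(u + vh₂) = p − nCv² ≡ 0 (mod p)`, so `p` divides `u + vh₁` or `u + vh₂`; in the
first case apply `properEquiv_div_of_repr`, in the second apply it to the representation
`p = (u + σv)² + σ(u + σv)(−v) + k(−v)²`, for which `(u + σv) + (−v)h₁ = u + vh₂`. [folklore] -/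
theorem properEquiv_div_of_prime_repr {p : ℕ} (hp : p.Prime) {n' B C σ k u v : ℤ}
    (hdisc : σ ^ 2 - 4 * k = B ^ 2 - 4 * ((p : ℤ) * n') * C)
    (hrep : (p : ℤ) = u ^ 2 + σ * u * v + k * v ^ 2) :
    (⟨(p : ℤ) * n', B, C⟩ : BinQF).ProperEquiv ⟨n', B, (p : ℤ) * C⟩ := by
  have hp0 : (p : ℤ) ≠ 0 := by exact_mod_cast hp.ne_zero
  obtain ⟨h, hh⟩ := exists_two_mul_eq_sub_of_disc_eq (σ := σ) (k := k) (B := B)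
    (m := (p : ℤ) * n' * C) (by linarith)
  have hσ : σ = 2 * h + B := by linarith
  subst hσ
  -- `(u + v h)(u + v (h + B)) = p - p n' C v²`
  have hprod : (u + v * h) * (u + v * (h + B)) = (p : ℤ) * (1 - n' * C * v ^ 2) := by
    have hk : k = h ^ 2 + h * B + (p : ℤ) * n' * C := by linarith
    subst hk
    linear_combination -hrep
  have hdvd : (p : ℤ) ∣ (u + v * h) * (u + v * (h + B)) := ⟨_, hprod⟩
  rcases Int.Prime.dvd_mul' hp hdvd with ⟨W, hW⟩ | ⟨W, hW⟩
  · exact properEquiv_div_of_repr hp0 hdisc hrep (by linarith)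
  · refine properEquiv_div_of_repr (u := u + (2 * h + B) * v) (v := -v) (W := W) hp0 hdisc ?_ ?_
    · linear_combination hrep
    · linarith

/-! ### Every class is principal -/

/-- **From the division step to the principal class.** Let `D = σ² − 4k` and `M` be given, and
suppose every prime `p ∤ M`, `p ∤ D` with `D` a square modulo `p` is represented by `(1, σ, k)`.
Then every form `f = (n, B, C)` of discriminant `D` with `n > 0` and `gcd(n, MD) = 1` is properly
equivalent to `(1, σ, k)`: induction on `n`, dividing out one prime factor of `n` at a time
(`properEquiv_div_of_prime_repr`; a prime `p ∣ n` has `D ≡ B² (mod p)`), and finally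
`(1, B, C') ~ (1, σ, k)` by `T^{(σ−B)/2}`. (Cox, Thm. 7.7 with Cor. 7.17, in the language of
forms.) [folklore] -/
theorem properEquiv_principal_of_forall_prime_repr {D M σ k : ℤ} (hσk : σ ^ 2 - 4 * k = D)
    (H : ∀ p : ℕ, p.Prime → ¬ (p : ℤ) ∣ M → ¬ (p : ℤ) ∣ D → (∃ B : ℤ, (p : ℤ) ∣ B ^ 2 - D) →
      ∃ u v : ℤ, (p : ℤ) = u ^ 2 + σ * u * v + k * v ^ 2)
    (f : BinQF) (hf : f.disc = D) (ha : 0 < f.a) (hcop : IsCoprime f.a (M * D)) :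
    f.ProperEquiv ⟨1, σ, k⟩ := by
  -- strong induction on `f.a`
  suffices key : ∀ (N : ℕ) (f : BinQF), f.a.natAbs ≤ N → f.disc = D → 0 < f.a →
      IsCoprime f.a (M * D) → f.ProperEquiv ⟨1, σ, k⟩ from
    key f.a.natAbs f le_rfl hf ha hcop
  intro N
  induction N with
  | zero =>
    intro f hN _ ha _
    have : f.a.natAbs = 0 := Nat.le_zero.1 hN
    omega
  | succ N ih =>
    intro f hN hf ha hcop
    obtain ⟨n, B, C⟩ := f
    simp only [disc] at hf hN ha hcop ⊢
    by_cases h1 : n = 1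
    · -- base case: `(1, B, C) ~ (1, σ, k)` by `T^j`, `2j = σ - B`
      subst h1
      obtain ⟨j, hj⟩ := exists_two_mul_eq_sub_of_disc_eq (σ := σ) (k := k) (B := B) (m := C)
        (by linarith)
      have hT := properEquiv_T ⟨1, B, C⟩ j
      have hkC : 1 * j ^ 2 + B * j + C = k := by
        have h4 : 4 * (1 * j ^ 2 + B * j + C - k) = 0 := by
          linear_combination hσk - hf + (2 * j + B + σ) * hj
        linarith
      simp only [mul_one] at hT
      rwa [show B + 2 * j = σ by linarith, hkC] at hT
    · -- a prime factor `p` of `n`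
      have hn1 : n.natAbs ≠ 1 := by omega
      obtain ⟨p, hp, hpn⟩ := Nat.exists_prime_and_dvd hn1
      have hpn' : (p : ℤ) ∣ n := Int.ofNat_dvd_left.2 hpn
      obtain ⟨n', rfl⟩ := hpn'
      have hp0 : (0 : ℤ) < p := by exact_mod_cast hp.pos
      have hn'pos : 0 < n' := pos_of_mul_pos_right ha hp0.le
      -- `p ∤ M`, `p ∤ D`
      have hpMD : ¬ (p : ℤ) ∣ M * D := fun hdvd => by
        have h2 : IsCoprime ((p : ℤ) * n') (M * D) := hcop
        have hu : IsUnit (p : ℤ) := h2.isUnit_of_dvd' (Dvd.intro _ rfl) hdvd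
        exact hp.ne_one (by simpa using Int.isUnit_iff_natAbs_eq.1 hu)
      have hpM : ¬ (p : ℤ) ∣ M := fun h => hpMD (h.mul_right D)
      have hpD : ¬ (p : ℤ) ∣ D := fun h => hpMD (h.mul_left M)
      -- `D ≡ B² (mod p)`
      have hsq : ∃ B₀ : ℤ, (p : ℤ) ∣ B₀ ^ 2 - D := ⟨B, ⟨4 * n' * C, by rw [← hf]; ring⟩⟩
      obtain ⟨u, v, hrep⟩ := H p hp hpM hpD hsq
      -- divide
      have hdiv : (⟨(p : ℤ) * n', B, C⟩ : BinQF).ProperEquiv ⟨n', B, (p : ℤ) * C⟩ :=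
        properEquiv_div_of_prime_repr hp (by rw [hσk, ← hf]) hrep
      refine hdiv.trans (ih ⟨n', B, (p : ℤ) * C⟩ ?_ ?_ hn'pos ?_)
      · -- `n' < p n'`
        have hlt : n' < (p : ℤ) * n' := by
          have h2 : (2 : ℤ) ≤ p := by exact_mod_cast hp.two_le
          nlinarith
        simp only
        omega
      · simp only [disc]; rw [← hf]; ring
      · simp only
        exact hcop.of_isCoprime_of_dvd_left (Dvd.intro_left _ rfl)

end Literature.NumberTheory.QuadraticFields.Quadratic.BinQF

/-! ### The class number one criterion in the triple encoding -/

namespace Literature.NumberTheory.QuadraticFields.BinaryQuadraticForm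

open Quadratic

/-- **If the principal form of discriminant `D` represents every prime `p ∤ M` at which `D` is a
non-zero square, then `h(D) = 1`.** Precisely: `D < 0`, `D ≡ 0, 1 (mod 4)`, `M ≠ 0`, and for every
prime number `p` with `p ∤ M`, `p ∤ D` and `p ∣ B² − D` for some `B` there are `u, v` with
`p = P(u, v)`, `P = principalForm D`; then `classNumber D = 1`. Every reduced form `Q` is properly
equivalent to a form with leading coefficient prime to `MD` (Cox, Lemmas 2.3 and 2.25), hence to
`P` (`BinQF.properEquiv_principal_of_forall_prime_repr`), and two properly equivalent reduced forms
coincide (Cox, Thm. 2.8), so `reducedForms D = {P}`. Ideal-theoretically: the class group of the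
order of discriminant `D` is generated by the classes of its degree-one primes outside `M`
(Cox, Thm. 7.7 and Cor. 7.17). [folklore] -/
theorem classNumber_eq_one_of_forall_prime_repr {D M : ℤ} (hD : D < 0)
    (h4 : D % 4 = 0 ∨ D % 4 = 1) (hM : M ≠ 0)
    (H : ∀ p : ℕ, p.Prime → ¬ (p : ℤ) ∣ M → ¬ (p : ℤ) ∣ D → (∃ B : ℤ, (p : ℤ) ∣ B ^ 2 - D) →
      ∃ u v : ℤ, (p : ℤ) = (principalForm D).1 * u ^ 2 + (principalForm D).2.1 * u * v +
        (principalForm D).2.2 * v ^ 2) :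
    classNumber D = 1 := by
  set σ := (principalForm D).2.1 with hσ
  set k := (principalForm D).2.2 with hk
  have hP1 : (principalForm D).1 = 1 := principalForm_fst D
  have hPeq : principalForm D = (1, σ, k) := by
    ext <;> simp [hP1, hσ, hk]
  have hσk : σ ^ 2 - 4 * k = D := by
    have := discr_principalForm h4
    rw [hPeq, discr_apply] at this
    linarith
  have H' : ∀ p : ℕ, p.Prime → ¬ (p : ℤ) ∣ M → ¬ (p : ℤ) ∣ D → (∃ B : ℤ, (p : ℤ) ∣ B ^ 2 - D) →
      ∃ u v : ℤ, (p : ℤ) = u ^ 2 + σ * u * v + k * v ^ 2 := by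
    intro p hp hpM hpD hsq
    obtain ⟨u, v, huv⟩ := H p hp hpM hpD hsq
    exact ⟨u, v, by rw [huv, hP1]; ring⟩
  -- every reduced form is the principal form
  have hsub : reducedForms D ⊆ {principalForm D} := by
    intro Q hQ
    rw [Finset.mem_singleton]
    obtain ⟨hdisc, hQ1, hprim, hred⟩ := (mem_reducedForms_iff hD).1 hQ
    set f : BinQF := ⟨Q.1, Q.2.1, Q.2.2⟩ with hf_def
    have hf : f.IsPosPrim D := ⟨hdisc, hQ1, hprim⟩
    have hfred : f.IsReduced := (isReduced_iff Q.1 Q.2.1 Q.2.2).1 hred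
    have hMD : M * D ≠ 0 := mul_ne_zero hM hD.ne
    obtain ⟨g, hfg, hg, hcop⟩ := BinQF.exists_properEquiv_isPosPrim_isCoprime_a hD hf hMD
    have hgP : g.ProperEquiv ⟨1, σ, k⟩ :=
      BinQF.properEquiv_principal_of_forall_prime_repr hσk H' g hg.disc_eq hg.a_pos hcop
    have hfP : f.ProperEquiv ⟨1, σ, k⟩ := hfg.trans hgP
    have hPpos : (⟨1, σ, k⟩ : BinQF).IsPosPrim D := hfP.isPosPrim hD hf
    have hPred : (⟨1, σ, k⟩ : BinQF).IsReduced := by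
      have := isReduced_principalForm hD h4
      rw [hPeq] at this
      exact (isReduced_iff 1 σ k).1 this
    have hfeq : f = ⟨1, σ, k⟩ := BinQF.eq_of_properEquiv_of_isReduced hf hPpos hfred hPred hfP
    rw [hPeq]
    obtain ⟨a, b, c⟩ := Q
    simp only [hf_def, BinQF.mk.injEq] at hfeq
    obtain ⟨rfl, rfl, rfl⟩ := hfeq
    rfl
  have hcard := Finset.card_le_card hsub
  rw [Finset.card_singleton] at hcard
  have hpos := classNumber_pos hD h4
  unfold classNumber at hpos ⊢
  omega

end Literature.NumberTheory.QuadraticFields.BinaryQuadraticForm
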